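import Literature.AlgebraicGeometry.Motives.HodgeThetaSubalgebraUnitaryFullRankPair
import HarnessLib

/-!
# Cutting raising and lowering operators of a `Θ`-subalgebra by its degree-zero idempotents (tool for the `(2,4)` complex core:
# the raising/lowering operators may be composed with every WORD in the rank-two idempotents; Ribet 1983 Thm. 3 beyond coprime
# multiplicities; Goodman–Wallach §4.1.1 gradings)

Topic `Literature/AlgebraicGeometry/Motives` (pure complex linear algebra; no geometry).  Theorems only (no definition, no named
fact; D-0026).  Written for the cell `pub-hodgeav-hg6` (req-37 (A) row 2, TABLE X row 8-`(4,2)`; brick U2c of the `(4,2)` programme;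
honest framing of that cell: HC / HC_AV / HC_CM / H2 NOT proved — THIS file is unconditional linear algebra and discharges no
hypothesis of the cell's cover).

SETTING.  `𝔊 ⊆ End(W)` closed under the commutator, `Θ² = 1` with eigenspaces `P = {Θ = 1}`, `Q = {Θ = −1}`; raising operators
`B` (`ΘB = B = −BΘ`: they kill `P` and map into `P`), lowering operators `C` (`ΘC = −C = −CΘ`: they kill `Q` and map into `Q`),
and operators `E ∈ 𝔊` KILLING `P` WITH VALUES IN `Q` — e.g. the rank-two idempotents of
`UnitaryThetaCore.exists_rankTwo_idempotent_two_four` (`HodgeThetaSubalgebraUnitaryFullRankPair`).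

* `UnitaryThetaCore.mul_eq_zero_of_killP_of_raise` (`E B = 0`), `UnitaryThetaCore.mul_eq_zero_of_lower_of_intoQ` (`C E = 0`);
* **`UnitaryThetaCore.raise_mul_mem`** — `B E = [B, E] ∈ 𝔊`, and `B E` is again raising; **`UnitaryThetaCore.mul_lower_mem`** —
  `E C = [E, C] ∈ 𝔊`, again lowering;
* **`UnitaryThetaCore.raise_mul_prod_mem`** / **`UnitaryThetaCore.prod_mul_lower_mem`** — by induction `B · (E₁ ⋯ E_k) ∈ 𝔊` and
  `(E₁ ⋯ E_k) · C ∈ 𝔊` for every list of such `E_i ∈ 𝔊` (products taken in `End(W)`): raising and lowering operators may be CUT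
  by every word of the associative algebra generated by the `E_i`, although `𝔊` is only a Lie algebra.
USE (the open core U2, `HOME/jobs/CRUX-42-eng5g4/CruxFourTwo.lean` of the cell): two rank-two idempotents `E, E′ ∈ 𝔊` whose ranges
meet in a line `L` generate, associatively, the projector `π_L` onto `L`; the cut operators `B π_L`, `π_L C ∈ 𝔊` are raising /
lowering of rank `≤ 1`, and `UnitaryThetaCore.aeval_sub_aeval_mem` applies to the pair (`(B π_L)² = 0`).

## References

* [Ribet1983] K. A. Ribet, *Hodge classes on certain types of abelian varieties*, Amer. J. Math. 105 (1983), Thm. 3.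
* [GoodmanWallachGTM255] R. Goodman, N. Wallach, *Symmetry, Representations, and Invariants*, §4.1.1 (gradings).
* [MoonenZarhin1999LowDim] B. Moonen, Yu. Zarhin, Math. Ann. 315 (1999), §2 (2.3)–(2.4).
-/

noncomputable section

open Module

namespace Literature.AlgebraicGeometry.Motives

namespace HodgeStructure

section Cuts

variable {W : Type*} [AddCommGroup W] [Module ℂ W]

/-- **`E B = 0`** when `E` kills `P` and `B` is raising (`B` maps into `P`). [cite: GoodmanWallachGTM255, §4.1.1] -/
theorem UnitaryThetaCore.mul_eq_zero_of_killP_of_raise {Θ E B : Module.End ℂ W} {P : Submodule ℂ W}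
    (hP : ∀ x, x ∈ P ↔ Θ x = x) (hEP : ∀ p ∈ P, E p = 0) (hΘB : Θ * B = B) : E * B = 0 := by
  refine LinearMap.ext fun w => ?_
  rw [Module.End.mul_apply, LinearMap.zero_apply]
  exact hEP _ ((hP _).2 (by rw [← Module.End.mul_apply, hΘB]))

/-- **`C E = 0`** when `E` maps into `Q` and `C` is lowering (`C` kills `Q`). [cite: GoodmanWallachGTM255, §4.1.1] -/
theorem UnitaryThetaCore.mul_eq_zero_of_lower_of_intoQ {Θ E C : Module.End ℂ W} {Q : Submodule ℂ W}
    (hQ : ∀ x, x ∈ Q ↔ Θ x = -x) (hEQ : ∀ w, E w ∈ Q) (hCΘ : C * Θ = C) : C * E = 0 := by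
  refine LinearMap.ext fun w => ?_
  rw [Module.End.mul_apply, LinearMap.zero_apply]
  have hq := (hQ _).1 (hEQ w)
  have h : C (E w) = -(C (E w)) := by
    conv_lhs => rw [← neg_neg (E w), ← hq, map_neg, ← Module.End.mul_apply, hCΘ]
  have h2 : (2 : ℂ) • C (E w) = 0 := by rw [two_smul]; nth_rewrite 2 [h]; rw [add_neg_cancel]
  exact (smul_eq_zero.1 h2).resolve_left two_ne_zero

/-- `E Θ = −E` when `E` kills `P` and `Θ² = 1` (decompose `w = P̂w + Q̂w`). [cite: GoodmanWallachGTM255, §4.1.1] -/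
theorem UnitaryThetaCore.mul_theta_eq_neg_of_killP {Θ E : Module.End ℂ W} (hΘΘ : Θ * Θ = 1) {P : Submodule ℂ W}
    (hP : ∀ x, x ∈ P ↔ Θ x = x) (hEP : ∀ p ∈ P, E p = 0) : E * Θ = -E := by
  have hΘΘv : ∀ v, Θ (Θ v) = v := fun v => by rw [← Module.End.mul_apply, hΘΘ, Module.End.one_apply]
  refine LinearMap.ext fun w => ?_
  have hp : w + Θ w ∈ P := (hP _).2 (by rw [map_add, hΘΘv, add_comm])
  have h0 : E w + E (Θ w) = 0 := by rw [← map_add]; exact hEP _ hp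
  rw [Module.End.mul_apply, LinearMap.neg_apply]
  exact eq_neg_of_add_eq_zero_right h0

/-- `Θ E = −E` when `E` maps into `Q`. [cite: GoodmanWallachGTM255, §4.1.1] -/
theorem UnitaryThetaCore.theta_mul_eq_neg_of_intoQ {Θ E : Module.End ℂ W} {Q : Submodule ℂ W}
    (hQ : ∀ x, x ∈ Q ↔ Θ x = -x) (hEQ : ∀ w, E w ∈ Q) : Θ * E = -E :=
  LinearMap.ext fun w => by rw [Module.End.mul_apply, LinearMap.neg_apply]; exact (hQ _).1 (hEQ w)

/-- **Cutting a raising operator: `B E = [B, E] ∈ 𝔊`, and `B E` is raising.**  (`E ∈ 𝔊` kills `P` and maps into `Q`; `B ∈ 𝔊`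
raising; `Θ² = 1`.) [cite: GoodmanWallachGTM255, §4.1.1] [cite: Ribet1983, Thm. 3] -/
theorem UnitaryThetaCore.raise_mul_mem {𝔊 : Submodule ℂ (Module.End ℂ W)}
    (hbr : ∀ Y ∈ 𝔊, ∀ Z ∈ 𝔊, Y * Z - Z * Y ∈ 𝔊) {Θ : Module.End ℂ W} (hΘΘ : Θ * Θ = 1) {P : Submodule ℂ W}
    (hP : ∀ x, x ∈ P ↔ Θ x = x) {E : Module.End ℂ W} (hE : E ∈ 𝔊) (hEP : ∀ p ∈ P, E p = 0)
    {B : Module.End ℂ W} (hB : B ∈ 𝔊) (hΘB : Θ * B = B) :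
    B * E ∈ 𝔊 ∧ Θ * (B * E) = B * E ∧ (B * E) * Θ = -(B * E) := by
  have hEB : E * B = 0 := UnitaryThetaCore.mul_eq_zero_of_killP_of_raise hP hEP hΘB
  have hEΘ : E * Θ = -E := UnitaryThetaCore.mul_theta_eq_neg_of_killP hΘΘ hP hEP
  refine ⟨?_, by rw [← mul_assoc, hΘB], by rw [mul_assoc, hEΘ, mul_neg]⟩
  have h := hbr B hB E hE
  rwa [hEB, sub_zero] at h

/-- **Cutting a lowering operator: `E C = [E, C] ∈ 𝔊`, and `E C` is lowering.**  (`E ∈ 𝔊` kills `P` and maps into `Q`; `C ∈ 𝔊`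
lowering; `Θ² = 1`.) [cite: GoodmanWallachGTM255, §4.1.1] [cite: Ribet1983, Thm. 3] -/
theorem UnitaryThetaCore.mul_lower_mem {𝔊 : Submodule ℂ (Module.End ℂ W)}
    (hbr : ∀ Y ∈ 𝔊, ∀ Z ∈ 𝔊, Y * Z - Z * Y ∈ 𝔊) {Θ : Module.End ℂ W} {Q : Submodule ℂ W}
    (hQ : ∀ x, x ∈ Q ↔ Θ x = -x) {E : Module.End ℂ W} (hE : E ∈ 𝔊) (hEQ : ∀ w, E w ∈ Q)
    {C : Module.End ℂ W} (hC : C ∈ 𝔊) (hCΘ : C * Θ = C) :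
    E * C ∈ 𝔊 ∧ Θ * (E * C) = -(E * C) ∧ (E * C) * Θ = E * C := by
  have hCE : C * E = 0 := UnitaryThetaCore.mul_eq_zero_of_lower_of_intoQ hQ hEQ hCΘ
  have hΘE : Θ * E = -E := UnitaryThetaCore.theta_mul_eq_neg_of_intoQ hQ hEQ
  refine ⟨?_, by rw [← mul_assoc, hΘE, neg_mul], by rw [mul_assoc, hCΘ]⟩
  have h := hbr E hE C hC
  rwa [hCE, sub_zero] at h

/-- **Raising operators may be cut by every WORD in such idempotents: `B · (E₁ ⋯ E_k) ∈ 𝔊`** (and it is raising), for a list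
of `E_i ∈ 𝔊` each killing `P` with values in `Q`. [cite: GoodmanWallachGTM255, §4.1.1] [cite: Ribet1983, Thm. 3] -/
theorem UnitaryThetaCore.raise_mul_prod_mem {𝔊 : Submodule ℂ (Module.End ℂ W)}
    (hbr : ∀ Y ∈ 𝔊, ∀ Z ∈ 𝔊, Y * Z - Z * Y ∈ 𝔊) {Θ : Module.End ℂ W} (hΘΘ : Θ * Θ = 1) {P Q : Submodule ℂ W}
    (hP : ∀ x, x ∈ P ↔ Θ x = x)
    (l : List (Module.End ℂ W)) (hl : ∀ E ∈ l, E ∈ 𝔊 ∧ (∀ p ∈ P, E p = 0) ∧ ∀ w, E w ∈ Q)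
    {B : Module.End ℂ W} (hB : B ∈ 𝔊) (hΘB : Θ * B = B) (hBΘ : B * Θ = -B) :
    B * l.prod ∈ 𝔊 ∧ Θ * (B * l.prod) = B * l.prod ∧ (B * l.prod) * Θ = -(B * l.prod) := by
  induction l generalizing B with
  | nil => simpa using ⟨hB, hΘB, hBΘ⟩
  | cons E l ih =>
    obtain ⟨hE, hEP, -⟩ := hl E (by simp)
    obtain ⟨hBE, hΘBE, hBEΘ⟩ := UnitaryThetaCore.raise_mul_mem hbr hΘΘ hP hE hEP hB hΘB
    have h := ih (fun E' hE' => hl E' (List.mem_cons_of_mem E hE')) hBE hΘBE hBEΘ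
    simpa [List.prod_cons, mul_assoc] using h

/-- **Lowering operators may be cut by every word: `(E₁ ⋯ E_k) · C ∈ 𝔊`** (and it is lowering).
[cite: GoodmanWallachGTM255, §4.1.1] [cite: Ribet1983, Thm. 3] -/
theorem UnitaryThetaCore.prod_mul_lower_mem {𝔊 : Submodule ℂ (Module.End ℂ W)}
    (hbr : ∀ Y ∈ 𝔊, ∀ Z ∈ 𝔊, Y * Z - Z * Y ∈ 𝔊) {Θ : Module.End ℂ W} {P Q : Submodule ℂ W}
    (hQ : ∀ x, x ∈ Q ↔ Θ x = -x)
    (l : List (Module.End ℂ W)) (hl : ∀ E ∈ l, E ∈ 𝔊 ∧ (∀ p ∈ P, E p = 0) ∧ ∀ w, E w ∈ Q)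
    {C : Module.End ℂ W} (hC : C ∈ 𝔊) (hΘC : Θ * C = -C) (hCΘ : C * Θ = C) :
    l.prod * C ∈ 𝔊 ∧ Θ * (l.prod * C) = -(l.prod * C) ∧ (l.prod * C) * Θ = l.prod * C := by
  induction l with
  | nil => simpa using ⟨hC, hΘC, hCΘ⟩
  | cons E l ih =>
    obtain ⟨hE, -, hEQ⟩ := hl E (by simp)
    obtain ⟨hlC, -, hlCΘ⟩ := ih (fun E' hE' => hl E' (List.mem_cons_of_mem E hE'))
    obtain ⟨h1, h2, h3⟩ := UnitaryThetaCore.mul_lower_mem hbr hQ hE hEQ hlC hlCΘ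
    simpa [List.prod_cons, mul_assoc] using ⟨h1, h2, h3⟩

end Cuts

end HodgeStructure

end Literature.AlgebraicGeometry.Motives

end
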